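import Literature.MathematicalPhysics.QuantumManyBody.JelliumBoseGasProofs
import HarnessLib

/-!
# The Coulomb singularity is integrable on the `N`-particle box; every trial state has finite jellium energy

Topic `Literature/MathematicalPhysics/QuantumManyBody` (the charged Bose gas, `JelliumBoseGas.foldyLaw`).
The pair potential `|xᵢ - xⱼ|⁻¹` is locally integrable on configuration space `(ℝ³)^N`: slicing
the `N`-particle box `Λ_L^N` at the particle `i` (Mathlib's measure-preserving
`piFinSuccAbove`) and using `∫_Λ |x - y|⁻¹ dx ≤ 6πL²` for `y ∈ Λ`
(`JelliumBoseGas.backgroundPotential_le`) gives `∫_{Λ^N} |xᵢ - xⱼ|⁻¹ dX ≤ 6πL² |Λ^{N-1}|`.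
Consequently the Coulomb energy `∫ ∑_{i<j}|xᵢ - xⱼ|⁻¹ |Ψ|²` of every (bounded, box-supported)
trial state is finite, and so is `chargedEnergy 0 q ρ Ψ` — the finite-energy hypothesis of the
sliding bound [LiebSolovej2001, Lemma 3.2] (`JelliumSlidingBound.lean`) holds for every trial state.

* `JelliumBoseGas.boxN_succ_eq_preimage` — `Λ^{n+1} = e⁻¹(Λ × Λ^n)` for the slicing map `e`;
* `JelliumBoseGas.setLIntegral_boxN_inv_norm_sub_le` — `∫_{Λ^{n+1}} |xᵢ - xⱼ|⁻¹ ≤ 6πL²|Λ^n|`;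
* `JelliumBoseGas.setLIntegral_boxN_sum_inv_norm_sub_ne_top` — `∫_{Λ^N} ∑_{i<j}|xᵢ - xⱼ|⁻¹ < ∞`;
* `JelliumBoseGas.lintegral_sum_inv_norm_sub_mul_ne_top` — `∫ ∑_{i<j}|xᵢ-xⱼ|⁻¹|Ψ|² < ∞`;
* `JelliumBoseGas.chargedEnergy_ne_top` — `chargedEnergy 0 q ρ Ψ < ∞` for every trial state
  (`ρ ≥ 0`).

## References

* [LiebSolovej2001] E. H. Lieb, J. P. Solovej, Commun. Math. Phys. 217 (2001) 127–163, §3.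
* [LSSY2005] Ch. 10 (10.1).
-/

noncomputable section

open MeasureTheory Set Filter Real
open scoped ENNReal NNReal Topology

namespace Literature.MathematicalPhysics.QuantumManyBody.JelliumBoseGas

open BoseGas

variable {n N : ℕ}

/-! ### Slicing the `N`-particle box at one particle -/

/-- `Λ_L^{n+1} = e⁻¹(Λ_L × Λ_L^n)` for the slicing map `e = piFinSuccAbove _ i`,
`X ↦ (xᵢ, (x_{σᵢ(j)})ⱼ)`. [folklore] -/
theorem boxN_succ_eq_preimage (i : Fin (n + 1)) (L : ℝ) :
    boxN (n + 1) L =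
      MeasurableEquiv.piFinSuccAbove (fun _ => Space) i ⁻¹' (box L ×ˢ boxN n L) := by
  ext X
  simp only [boxN, mem_setOf_eq, mem_preimage, MeasurableEquiv.piFinSuccAbove_apply,
    Fin.insertNthEquiv_symm_apply, mem_prod, Fin.removeNth_apply]
  rw [Fin.forall_iff_succAbove i]

/-- `∫_Λ |x - y|⁻¹ dx ≤ 6πL²` for `y ∈ Λ_L`, in `ℝ≥0∞`. [cite: LSSY2005, Ch. 10 (10.1)] -/
theorem setLIntegral_box_inv_norm_sub_le {L : ℝ} {y : Space} (hy : y ∈ box L) :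
    ∫⁻ x in box L, ENNReal.ofReal ‖x - y‖⁻¹ ≤ ENNReal.ofReal (6 * π * L ^ 2) := by
  have e : ∀ x : Space, ‖x - y‖⁻¹ = ‖y - x‖⁻¹ := fun x => by rw [norm_sub_rev]
  simp_rw [e]
  rw [← ofReal_integral_eq_lintegral_ofReal (integrableOn_inv_norm_sub_box y L)
    (Eventually.of_forall fun x => inv_nonneg.2 (norm_nonneg _))]
  exact ENNReal.ofReal_le_ofReal (backgroundPotential_le hy)

/-- **The Coulomb singularity is integrable on the `N`-particle box**: for `i ≠ j`,
`∫_{Λ_L^{n+1}} |xᵢ - xⱼ|⁻¹ dX ≤ 6πL² · |Λ_L^n|` (slice at the particle `i`, integrate `xᵢ` first).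
[folklore] -/
theorem setLIntegral_boxN_inv_norm_sub_le (i j : Fin (n + 1)) (hij : i ≠ j) (L : ℝ) :
    ∫⁻ X in boxN (n + 1) L, ENNReal.ofReal ‖X i - X j‖⁻¹ ≤
      ENNReal.ofReal (6 * π * L ^ 2) * volume (boxN n L) := by
  obtain ⟨k, hk⟩ := Fin.exists_succAbove_eq hij.symm
  set e := MeasurableEquiv.piFinSuccAbove (fun _ : Fin (n + 1) => Space) i with he
  have hmp : MeasurePreserving e volume (volume.prod volume) :=
    volume_preserving_piFinSuccAbove _ i
  set G : Space × Config n → ℝ≥0∞ := fun p => ENNReal.ofReal ‖p.1 - p.2 k‖⁻¹ with hG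
  have hsub : Measurable fun p : Space × Config n => p.1 - p.2 k :=
    measurable_fst.sub ((measurable_pi_apply k).comp measurable_snd)
  have hGm : Measurable G := hsub.norm.inv.ennreal_ofReal
  have hcomp : ∀ X : Config (n + 1), ENNReal.ofReal ‖X i - X j‖⁻¹ = G (e X) := by
    intro X
    simp only [hG, he, MeasurableEquiv.piFinSuccAbove_apply, Fin.insertNthEquiv_symm_apply,
      Fin.removeNth_apply, hk]
  simp_rw [hcomp]
  rw [boxN_succ_eq_preimage i L, hmp.setLIntegral_comp_preimage_emb e.measurableEmbedding,
    ← Measure.prod_restrict, lintegral_prod_symm _ hGm.aemeasurable]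
  calc ∫⁻ R in boxN n L, ∫⁻ x in box L, G (x, R)
      ≤ ∫⁻ _ in boxN n L, ENNReal.ofReal (6 * π * L ^ 2) :=
        setLIntegral_mono measurable_const fun R hR => setLIntegral_box_inv_norm_sub_le (hR k)
    _ = ENNReal.ofReal (6 * π * L ^ 2) * volume (boxN n L) := setLIntegral_const _ _

/-- `X ↦ |xᵢ - xⱼ|⁻¹` is measurable on configuration space (as an `ℝ≥0∞`-valued function).
[folklore] -/
theorem measurable_ofReal_inv_norm_sub (i j : Fin N) :
    Measurable fun X : Config N => ENNReal.ofReal ‖X i - X j‖⁻¹ := by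
  have h : Measurable fun X : Config N => X i - X j :=
    (measurable_pi_apply i).sub (measurable_pi_apply j)
  exact h.norm.inv.ennreal_ofReal

/-- **`∫_{Λ^N} ∑_{i<j} |xᵢ - xⱼ|⁻¹ dX < ∞`.** [folklore] -/
theorem setLIntegral_boxN_sum_inv_norm_sub_ne_top (N : ℕ) (L : ℝ) :
    ∫⁻ X in boxN N L, ∑ i, ∑ j with i < j, ENNReal.ofReal ‖X i - X j‖⁻¹ ≠ ⊤ := by
  cases N with
  | zero => simp
  | succ n =>
    rw [lintegral_finsetSum _ fun i _ => Finset.measurable_sum _ fun j _ =>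
      measurable_ofReal_inv_norm_sub i j]
    refine ENNReal.sum_ne_top.2 fun i _ => ?_
    rw [lintegral_finsetSum _ fun j _ => measurable_ofReal_inv_norm_sub i j]
    refine ENNReal.sum_ne_top.2 fun j hj => ?_
    have hij : i ≠ j := (Finset.mem_filter.1 hj).2.ne
    exact ne_top_of_le_ne_top (ENNReal.mul_ne_top ENNReal.ofReal_ne_top
      (volume_boxN_lt_top n L).ne) (setLIntegral_boxN_inv_norm_sub_le i j hij L)

/-- A trial state is bounded. [folklore] -/
theorem trialState_exists_norm_le {L : ℝ} (Ψ : TrialState N L) :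
    ∃ B : ℝ, ∀ X, ‖Ψ.ψ X‖ ≤ B := by
  obtain ⟨B, hB⟩ := Ψ.contDiff.continuous.norm.bddAbove_range_of_hasCompactSupport
    (hasCompactSupport_of_eq_zero_boxN Ψ.eq_zero).norm
  exact ⟨B, fun X => hB ⟨X, rfl⟩⟩

/-- **The Coulomb energy of a trial state is finite**: `∫ ∑_{i<j}|xᵢ - xⱼ|⁻¹ |Ψ|² < ∞` for every
trial state `Ψ` (bounded, supported in `Λ^N`). [folklore] -/
theorem lintegral_sum_inv_norm_sub_mul_ne_top {L : ℝ} (Ψ : TrialState N L) :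
    ∫⁻ X, (∑ i, ∑ j with i < j, ENNReal.ofReal ‖X i - X j‖⁻¹) * (‖Ψ.ψ X‖₊ : ℝ≥0∞) ^ 2 ≠ ⊤ := by
  obtain ⟨B, hB⟩ := trialState_exists_norm_le Ψ
  have hw : ∀ X, (‖Ψ.ψ X‖₊ : ℝ≥0∞) ^ 2 ≤ ENNReal.ofReal (B ^ 2) := fun X => by
    rw [← enorm_eq_nnnorm, ← ofReal_norm, ← ENNReal.ofReal_pow (norm_nonneg _)]
    exact ENNReal.ofReal_le_ofReal (pow_le_pow_left₀ (norm_nonneg _) (hB X) 2)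
  have hsupp : (Function.support fun X : Config N =>
      (∑ i, ∑ j with i < j, ENNReal.ofReal ‖X i - X j‖⁻¹) * (‖Ψ.ψ X‖₊ : ℝ≥0∞) ^ 2) ⊆ boxN N L := by
    intro X hX
    by_contra h
    exact hX (by simp [Ψ.eq_zero X h])
  rw [← setLIntegral_eq_of_support_subset hsupp]
  refine ne_top_of_le_ne_top (ENNReal.mul_ne_top (setLIntegral_boxN_sum_inv_norm_sub_ne_top N L)
    (ENNReal.ofReal_ne_top : ENNReal.ofReal (B ^ 2) ≠ ⊤)) ?_
  rw [← lintegral_mul_const' _ _ ENNReal.ofReal_ne_top]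
  exact lintegral_mono fun X => mul_le_mul' le_rfl (hw X)

/-- The jellium interaction is dominated by the pair repulsion plus `6πρL²` per particle
(the attraction `-ρV_Λ(xᵢ) ≤ 0` is dropped). [cite: LSSY2005, Ch. 10 (10.1)] -/
theorem jelliumInteraction_le {ρb : ℝ} (hρ : 0 ≤ ρb) (L : ℝ) (X : Config N) :
    jelliumInteraction ρb N L X ≤ (∑ i, ∑ j with i < j, ENNReal.ofReal ‖X i - X j‖⁻¹) +
      N * ENNReal.ofReal (ρb * (6 * π * L ^ 2)) := by
  rw [jelliumInteraction_eq]
  refine add_le_add le_rfl ?_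
  calc ∑ i : Fin N, ENNReal.ofReal (ρb * (6 * π * L ^ 2 - backgroundPotential L (X i)))
      ≤ ∑ _i : Fin N, ENNReal.ofReal (ρb * (6 * π * L ^ 2)) :=
        Finset.sum_le_sum fun i _ => ENNReal.ofReal_le_ofReal (mul_le_mul_of_nonneg_left
          (sub_le_self _ (backgroundPotential_nonneg L (X i))) hρ)
    _ = N * ENNReal.ofReal (ρb * (6 * π * L ^ 2)) := by
        rw [Finset.sum_const, Finset.card_univ, Fintype.card_fin, nsmul_eq_mul]

/-- **Every trial state has finite jellium energy**: `chargedEnergy 0 q ρ Ψ < ∞` for `ρ ≥ 0`.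
[cite: LSSY2005, Ch. 10 (10.1)] -/
theorem chargedEnergy_ne_top {L : ℝ} (q : ℝ) {ρb : ℝ} (hρ : 0 ≤ ρb) (Ψ : TrialState N L) :
    chargedEnergy 0 q ρb Ψ ≠ ⊤ := by
  have hkin : energy 0 Ψ ≠ ⊤ := by
    have : energy 0 Ψ = ∫⁻ X, kineticDensity Ψ.ψ X := by simp [energy, interaction]
    rw [this]
    exact Ψ.lintegral_kineticDensity_lt_top.ne
  have hmeas : Measurable fun X : Config N =>
      (∑ i, ∑ j with i < j, ENNReal.ofReal ‖X i - X j‖⁻¹) * (‖Ψ.ψ X‖₊ : ℝ≥0∞) ^ 2 :=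
    (Finset.measurable_sum _ fun i _ => Finset.measurable_sum _ fun j _ =>
      measurable_ofReal_inv_norm_sub i j).mul
      ((Ψ.contDiff.continuous.measurable.nnnorm.coe_nnreal_ennreal).pow_const _)
  have hpot : ∫⁻ X, jelliumInteraction ρb N L X * (‖Ψ.ψ X‖₊ : ℝ≥0∞) ^ 2 ≠ ⊤ := by
    refine ne_top_of_le_ne_top ?_ (lintegral_mono fun X =>
      mul_le_mul' (jelliumInteraction_le hρ L X) le_rfl)
    simp_rw [add_mul]
    rw [lintegral_add_left hmeas, lintegral_const_mul' _ _
      (ENNReal.mul_ne_top (ENNReal.natCast_ne_top N) ENNReal.ofReal_ne_top), Ψ.norm_eq, mul_one]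
    exact ENNReal.add_ne_top.2 ⟨lintegral_sum_inv_norm_sub_mul_ne_top Ψ,
      ENNReal.mul_ne_top (ENNReal.natCast_ne_top N) ENNReal.ofReal_ne_top⟩
  unfold chargedEnergy
  exact ENNReal.add_ne_top.2 ⟨hkin, ENNReal.mul_ne_top ENNReal.ofReal_ne_top hpot⟩

end Literature.MathematicalPhysics.QuantumManyBody.JelliumBoseGas
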